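import Mathlib

/-!
# The sequential-averaging product bound `∏_{m<n} (1 + W/m) ≤ (e·n)^W`

Kernel anchor for `DENSITY-XY.md` THEOREM G.34, Step 6 (repair cell b2b-imbrie, XY / free-fermion
rung).  Averaging the bond majorant `∏ⱼ (1 + z(gapⱼ(σ)))` over a uniformly random vertex `σ` of the
permutohedron one site at a time gives `E ∏ⱼ (1 + zⱼ) ≤ ∏_{j=1}^{n-1} (1 + W/(n-j)) = ∏_{m=1}^{n-1} (1 + W/m)`
with `W = 18.3/G²`; the elementary estimate recorded here is
`∏_{m=1}^{n} (1 + W/m) ≤ exp(W·H_n) ≤ exp(W (1 + log n)) = (e·n)^W` (`W ≥ 0`, `n ≥ 1`), via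
`1 + x ≤ eˣ` and the harmonic bound `H_n ≤ 1 + log n` of Mathlib.  Elementary real analysis only;
nothing here asserts anything about the interacting chain (LLA).
-/

namespace Literature.MathematicalPhysics.QuantumLattice.Imbrie2016

open Finset

/-- The harmonic sum in real form: `Σ_{i<n} 1/(i+1) ≤ 1 + log n`.  [folklore] -/
theorem sum_range_inv_succ_le_one_add_log (n : ℕ) :
    ∑ i ∈ range n, ((i : ℝ) + 1)⁻¹ ≤ 1 + Real.log n := by
  have h := harmonic_le_one_add_log n
  have e : ((harmonic n : ℚ) : ℝ) = ∑ i ∈ range n, ((i : ℝ) + 1)⁻¹ := by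
    simp [harmonic, Rat.cast_sum, Rat.cast_inv]
  rw [e] at h
  exact h

/-- **Sequential-averaging product bound**: for `W ≥ 0`,
`∏_{i<n} (1 + W/(i+1)) ≤ exp (W · (1 + log n))`.  [folklore] -/
theorem prod_one_add_div_succ_le_exp (W : ℝ) (hW : 0 ≤ W) (n : ℕ) :
    ∏ i ∈ range n, (1 + W / ((i : ℝ) + 1)) ≤ Real.exp (W * (1 + Real.log n)) := by
  have hpos : ∀ i : ℕ, 0 < (i : ℝ) + 1 := fun i => by positivity
  calc ∏ i ∈ range n, (1 + W / ((i : ℝ) + 1))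
      ≤ ∏ i ∈ range n, Real.exp (W / ((i : ℝ) + 1)) := by
        refine Finset.prod_le_prod (fun i _ => ?_) fun i _ => ?_
        · have : 0 ≤ W / ((i : ℝ) + 1) := div_nonneg hW (hpos i).le
          linarith
        · linarith [Real.add_one_le_exp (W / ((i : ℝ) + 1))]
    _ = Real.exp (∑ i ∈ range n, W / ((i : ℝ) + 1)) := (Real.exp_sum _ _).symm
    _ ≤ Real.exp (W * (1 + Real.log n)) := by
        refine Real.exp_le_exp.2 ?_
        have hs : ∑ i ∈ range n, W / ((i : ℝ) + 1) = W * ∑ i ∈ range n, ((i : ℝ) + 1)⁻¹ := by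
          rw [Finset.mul_sum]
          refine Finset.sum_congr rfl fun i _ => ?_
          rw [div_eq_mul_inv]
        rw [hs]
        exact mul_le_mul_of_nonneg_left (sum_range_inv_succ_le_one_add_log n) hW

/-- The same bound written as a real power: `exp (W (1 + log n)) = (e·n)^W` for `n ≥ 1`.  [folklore] -/
theorem exp_mul_one_add_log_eq_rpow (W : ℝ) (n : ℕ) (hn : 1 ≤ n) :
    Real.exp (W * (1 + Real.log n)) = (Real.exp 1 * n) ^ W := by
  have hn' : (0 : ℝ) < n := by exact_mod_cast hn
  have hpos : 0 < Real.exp 1 * (n : ℝ) := mul_pos (Real.exp_pos 1) hn'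
  rw [Real.rpow_def_of_pos hpos, Real.log_mul (Real.exp_pos 1).ne' hn'.ne', Real.log_exp]
  ring_nf

/-- **G.34 Step 6 form**: for `W ≥ 0` and `n ≥ 1`, `∏_{m=1}^{n} (1 + W/m) ≤ (e·n)^W`
(indexing `m = i + 1`, `i < n`).  [folklore] -/
theorem prod_one_add_div_succ_le_rpow (W : ℝ) (hW : 0 ≤ W) (n : ℕ) (hn : 1 ≤ n) :
    ∏ i ∈ range n, (1 + W / ((i : ℝ) + 1)) ≤ (Real.exp 1 * n) ^ W := by
  rw [← exp_mul_one_add_log_eq_rpow W n hn]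
  exact prod_one_add_div_succ_le_exp W hW n

/-- Reindexing used in Step 6: `∏_{j<n} f (n - 1 - j) = ∏_{j<n} f j` (the conditional expectations
come in the order `W/(n-j)`).  [folklore] -/
theorem prod_range_reflect' (f : ℕ → ℝ) (n : ℕ) :
    ∏ j ∈ range n, f (n - 1 - j) = ∏ j ∈ range n, f j :=
  Finset.prod_range_reflect f n

end Literature.MathematicalPhysics.QuantumLattice.Imbrie2016
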